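import Mathlib.Analysis.Calculus.Gradient.Basic
import Literature.Geometry.Lorentzian.ModelDataProofs
import Literature.Geometry.Lorentzian.MinkowskiCauchy
import HarnessLib

/-!
# Spacelike entire graphs in Minkowski space-time: embedding, differential, unit normal,
# induced metric

Elementary geometry of the hypersurface `{(u(y), y) | y ∈ ℝ³} ⊆ (ℝ⁴, η, ∂ₜ)` defined by a
function `u : ℝ³ → ℝ` over the slice `{t = 0}` — the shape in which the rigid positive energy
theorem (Beig–Chruściel, J. Math. Phys. 37 (1996), Thm. 4.1, `m = 0`; named fact
`Literature.Geometry.Lorentzian.positive_mass_rigidity_spacetime`) produces its isometric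
embedding into Minkowski space-time (proof of Thm. 4.1, last paragraph: "necessarily a graph over
a spacelike plane `t = 0`"; see `MinkowskiCauchyGraph.lean`,
`SpacetimePositiveMassRigidityProofs.lean`), and the curved analogue of the slice `y ↦ (0, y)` of
`ModelData.lean`. Everything is proved from Mathlib (theorems only; no definition, no named fact;
the graph map is written `fun y ↦ E4.ofTimeSpace (u y) y` throughout):

* (private) `bilin_ofTimeSpace` — `η((s, v), (t, w)) = −s t + ⟪v, w⟫`.
* `Minkowski.isClosedEmbedding_graph` — for continuous `u` the graph map is a closed topological
  embedding `ℝ³ → ℝ⁴` (left inverse the spatial projection; the image `{x⁰ = u(x̲)}` is closed).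
* `Minkowski.hasFDerivAt_graph`, `fderiv_graph_apply`, `injective_fderiv_graph` — for `u`
  differentiable at `y` the graph map has the injective differential `v ↦ (du_y(v), v)`;
  `Minkowski.contDiff_graph` — it is `C^n` when `u` is.
* The **unit normal**. For a vector `p ∈ ℝ³` with `‖p‖ < 1` (the gradient `∇u(y)`):
  `Minkowski.bilin_ofTimeSpace_one_tangent` — `(1, p)` is `η`-orthogonal to every `(⟪p, v⟫, v)`;
  `Minkowski.bilin_ofTimeSpace_one_self` — `η((1,p),(1,p)) = ‖p‖² − 1 < 0`;
  `Minkowski.bilin_unitNormal_self`, `bilin_basisVector_zero_unitNormal`,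
  `bilin_unitNormal_tangent` — `ν = (1 − ‖p‖²)^{-1/2} (1, p)` is a future-directed unit timelike
  vector `η`-orthogonal to the tangent space of the graph (O'Neill 1983, Ch. 5, p. 145; Wald 1984,
  §10.2: the future unit normal of a spacelike hypersurface).
* The **induced metric**: `Minkowski.bilin_tangent_tangent` —
  `η((⟪p,v⟫, v), (⟪p,w⟫, w)) = ⟪v, w⟫ − ⟪p, v⟫⟪p, w⟫`, and `Minkowski.bilin_tangent_self_ge` —
  it dominates `(1 − ‖p‖²)‖v‖²`, so the graph is spacelike, uniformly so when `‖∇u‖ ≤ θ < 1`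
  (the hypothesis of `Minkowski.isCauchyHypersurface_range_graph_of_fderiv`).
* `Minkowski.fderiv_graph_apply_eq_gradient` — `d(graph u)_y v = (⟪∇u(y), v⟫, v)`, linking the
  two groups.
* `Minkowski.isImmersion_graph`, `Minkowski.isSmoothEmbedding_graph` — for `C^∞` `u` the graph
  map is a `C^∞` immersion in the chart sense of Mathlib's `Manifold.IsImmersion` (identity chart
  of `ℝ³`, *sheared* chart `x ↦ x − u(x̲) ∂ₜ` of `ℝ⁴`, in which it reads `y ↦ (0, y)`), hence a
  smooth embedding (Hawking–Ellis 1973, §2.3: an imbedding); the case `u = 0` is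
  `Minkowski.isSmoothEmbedding_sliceEmbed_holds` (`ModelData`).

## References

* B. O'Neill, *Semi-Riemannian geometry*, Academic Press 1983, Ch. 3, p. 55 (`ℝ⁴₁`); Ch. 4,
  pp. 97–98 (hypersurfaces, normal vectors); Ch. 5, p. 145 (timecones). [ONeill1983]
* R. M. Wald, *General Relativity*, Chicago 1984, §10.2 (unit normal and induced metric of a
  spacelike hypersurface, (10.2.10)–(10.2.13)). [Wald1984]
* R. Beig, P. T. Chruściel, J. Math. Phys. 37 (1996) 1939–1961, proof of Thm. 4.1.
  [BeigChrusciel1996]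
-/

noncomputable section

open Set Function Topology InnerProductSpace
open scoped Manifold ContDiff RealInnerProductSpace Gradient

namespace Literature.Geometry.Lorentzian

namespace Minkowski

/-! ### The Minkowski form on time–space split vectors -/

/-- `η((s, v), (t, w)) = −s t + ⟪v, w⟫` (O'Neill 1983, Ch. 3, p. 55: `ℝ⁴₁`). Private helper: the
same statement is proved Summits-side (`…MinkowskiSphereSection.bilin_ofTimeSpace`), which
Literature cannot import; `Minkowski.bilin_ofTimeSpace_zero` (`ModelDataProofs`) is the case
`s = t = 0`. [cite: ONeill1983, Ch. 3, p. 55] -/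
private theorem bilin_ofTimeSpace (s t : ℝ) (v w : E3) :
    bilin (E4.ofTimeSpace s v) (E4.ofTimeSpace t w) = -(s * t) + ⟪v, w⟫ := by
  rw [bilin_apply]
  simp only [E4.ofTimeSpace_apply_zero, E4.ofTimeSpace_apply_succ, PiLp.inner_apply,
    RCLike.inner_apply, conj_trivial]
  congr 1
  exact Finset.sum_congr rfl fun i _ ↦ mul_comm _ _

/-! ### The graph map is a closed embedding -/

/-- The graph map `y ↦ (u(y), y)` of a continuous function is continuous
(`(u(y), y) = u(y) ∂ₜ + (0, y)`). [folklore] -/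
theorem continuous_graph {u : E3 → ℝ} (hu : Continuous u) :
    Continuous fun y : E3 ↦ E4.ofTimeSpace (u y) y := by
  have : (fun y : E3 ↦ E4.ofTimeSpace (u y) y) =
      fun y ↦ u y • E4.basisVector 0 + E4.ofTimeSpace 0 y :=
    funext fun y ↦ E4.ofTimeSpace_eq_smul_add (u y) y
  rw [this]
  exact (hu.smul continuous_const).add (E4.continuous_ofTimeSpace 0)

/-- **The graph of a continuous function over `{t = 0}` is a closed embedded copy of `ℝ³` in
`ℝ⁴`**: `y ↦ (u(y), y)` is a closed topological embedding — it has the continuous left inverse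
`x ↦ x̲` (`Topology.IsEmbedding.of_leftInverse`) and its image `{x | x⁰ = u(x̲)}` is closed.
O'Neill 1983, Ch. 4, p. 97 (hypersurfaces as embedded submanifolds); Hawking–Ellis 1973, §2.3
(imbeddings). [cite: ONeill1983, Ch. 4, p. 97] -/
theorem isClosedEmbedding_graph {u : E3 → ℝ} (hu : Continuous u) :
    IsClosedEmbedding fun y : E3 ↦ E4.ofTimeSpace (u y) y := by
  refine ⟨IsEmbedding.of_leftInverse (f := E4.spatial) (fun y ↦ E4.spatial_ofTimeSpace (u y) y)
    E4.spatial.continuous (continuous_graph hu), ?_⟩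
  have hrange :
      range (fun y : E3 ↦ E4.ofTimeSpace (u y) y) = {x : E4 | x 0 = u (E4.spatial x)} := by
    ext x
    constructor
    · rintro ⟨y, rfl⟩
      simp
    · intro hx
      refine ⟨E4.spatial x, ?_⟩
      have h := E4.ofTimeSpace_time_spatial x
      rw [E4.time_apply, hx] at h
      exact h
  rw [hrange]
  exact isClosed_eq ((EuclideanSpace.proj (0 : Fin 4)).continuous)
    (hu.comp E4.spatial.continuous)

/-! ### The differential of the graph map -/

/-- The graph map of a function differentiable at `y` is differentiable at `y` with differential
`v ↦ du_y(v) ∂ₜ + (0, v)` (`(u, y) = u ∂ₜ + (0, y)` with `(0, ·)` linear,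
`Minkowski.isLinearMap_ofTimeSpace_zero`). [folklore] -/
theorem hasFDerivAt_graph {u : E3 → ℝ} {y : E3} (hu : DifferentiableAt ℝ u y) :
    HasFDerivAt (fun y : E3 ↦ E4.ofTimeSpace (u y) y)
      ((fderiv ℝ u y).smulRight (E4.basisVector 0) +
        LinearMap.toContinuousLinearMap (IsLinearMap.mk' _ isLinearMap_ofTimeSpace_zero)) y := by
  set L : E3 →L[ℝ] E4 :=
    LinearMap.toContinuousLinearMap (IsLinearMap.mk' _ isLinearMap_ofTimeSpace_zero) with hL
  have hcoe : (L : E3 → E4) = E4.ofTimeSpace 0 := rfl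
  have : (fun y : E3 ↦ E4.ofTimeSpace (u y) y) =
      fun y ↦ u y • E4.basisVector 0 + L y :=
    funext fun y ↦ by rw [hcoe, E4.ofTimeSpace_eq_smul_add (u y) y]
  rw [this]
  exact (hu.hasFDerivAt.smul_const (E4.basisVector 0)).add L.hasFDerivAt

/-- **The differential of the graph map is `v ↦ (du_y(v), v)`.** [folklore] -/
theorem fderiv_graph_apply {u : E3 → ℝ} {y : E3} (hu : DifferentiableAt ℝ u y) (v : E3) :
    fderiv ℝ (fun y : E3 ↦ E4.ofTimeSpace (u y) y) y v = E4.ofTimeSpace (fderiv ℝ u y v) v := by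
  rw [(hasFDerivAt_graph hu).fderiv, E4.ofTimeSpace_eq_smul_add (fderiv ℝ u y v) v]
  rfl

/-- The differential of the graph map in terms of the gradient: `d(graph u)_y v = (⟪∇u(y), v⟫, v)`
(`inner_gradient_left`). [folklore] -/
theorem fderiv_graph_apply_eq_gradient {u : E3 → ℝ} {y : E3} (hu : DifferentiableAt ℝ u y)
    (v : E3) :
    fderiv ℝ (fun y : E3 ↦ E4.ofTimeSpace (u y) y) y v = E4.ofTimeSpace ⟪∇ u y, v⟫ v := by
  rw [fderiv_graph_apply hu, inner_gradient_left]

/-- **The graph map is an immersion at the level of differentials**: `v ↦ (du_y(v), v)` is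
injective (its spatial part is `v`). O'Neill 1983, Ch. 4, p. 97. [cite: ONeill1983, Ch. 4, p. 97] -/
theorem injective_fderiv_graph {u : E3 → ℝ} {y : E3} (hu : DifferentiableAt ℝ u y) :
    Injective (fderiv ℝ (fun y : E3 ↦ E4.ofTimeSpace (u y) y) y) := by
  intro v w h
  rw [fderiv_graph_apply hu, fderiv_graph_apply hu] at h
  simpa using congrArg E4.spatial h

/-- The graph map of a `C^n` function is `C^n`. [folklore] -/
theorem contDiff_graph {u : E3 → ℝ} {n : ℕ∞ω} (hu : ContDiff ℝ n u) :
    ContDiff ℝ n fun y : E3 ↦ E4.ofTimeSpace (u y) y := by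
  set L : E3 →L[ℝ] E4 :=
    LinearMap.toContinuousLinearMap (IsLinearMap.mk' _ isLinearMap_ofTimeSpace_zero) with hL
  have hcoe : (L : E3 → E4) = E4.ofTimeSpace 0 := rfl
  have : (fun y : E3 ↦ E4.ofTimeSpace (u y) y) =
      fun y ↦ u y • E4.basisVector 0 + L y :=
    funext fun y ↦ by rw [hcoe, E4.ofTimeSpace_eq_smul_add (u y) y]
  rw [this]
  exact (hu.smul contDiff_const).add L.contDiff

/-! ### The unit normal and the induced metric (pointwise algebra in `ℝ⁴₁`) -/

/-- The vector `(1, p)` is `η`-orthogonal to the tangent vectors `(⟪p, v⟫, v)` of the graph of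
a function with gradient `p`: `η((1, p), (⟪p, v⟫, v)) = −⟪p, v⟫ + ⟪p, v⟫ = 0`. Wald 1984, §10.2
(the normal `n_a ∝ ∇_a t − ∇_a u`). [cite: Wald1984, §10.2] -/
theorem bilin_ofTimeSpace_one_tangent (p v : E3) :
    bilin (E4.ofTimeSpace 1 p) (E4.ofTimeSpace ⟪p, v⟫ v) = 0 := by
  rw [bilin_ofTimeSpace]; ring

/-- `η((1, p), (1, p)) = ‖p‖² − 1`; in particular `(1, p)` is timelike iff `‖p‖ < 1`.
O'Neill 1983, Ch. 5, p. 145. [cite: ONeill1983, Ch. 5, p. 145] -/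
theorem bilin_ofTimeSpace_one_self (p : E3) :
    bilin (E4.ofTimeSpace 1 p) (E4.ofTimeSpace 1 p) = ‖p‖ ^ 2 - 1 := by
  rw [bilin_ofTimeSpace, real_inner_self_eq_norm_sq]; ring

/-- **The unit normal of a spacelike graph is a unit timelike vector**: for `‖p‖ < 1`,
`ν = (1 − ‖p‖²)^{-1/2} (1, p)` satisfies `η(ν, ν) = −1`. Wald 1984, §10.2, (10.2.10);
O'Neill 1983, Ch. 4, p. 98. [cite: Wald1984, §10.2 (10.2.10)] -/
theorem bilin_unitNormal_self {p : E3} (hp : ‖p‖ < 1) :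
    bilin ((Real.sqrt (1 - ‖p‖ ^ 2))⁻¹ • E4.ofTimeSpace 1 p)
      ((Real.sqrt (1 - ‖p‖ ^ 2))⁻¹ • E4.ofTimeSpace 1 p) = -1 := by
  have h1 : 0 < 1 - ‖p‖ ^ 2 := by nlinarith [norm_nonneg p]
  have hs : Real.sqrt (1 - ‖p‖ ^ 2) ^ 2 = 1 - ‖p‖ ^ 2 := Real.sq_sqrt h1.le
  have hs0 : Real.sqrt (1 - ‖p‖ ^ 2) ≠ 0 := (Real.sqrt_pos.mpr h1).ne'
  simp only [map_smul, FunLike.coe_smul, Pi.smul_apply, smul_eq_mul,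
    bilin_ofTimeSpace_one_self]
  field_simp
  nlinarith [hs]

/-- **The unit normal of a spacelike graph is future-directed**:
`η(∂ₜ, ν) = −(1 − ‖p‖²)^{-1/2} < 0`.
O'Neill 1983, Ch. 5, p. 145 (timecones of `ℝ⁴₁`); Wald 1984, §10.2.
[cite: ONeill1983, Ch. 5, p. 145] -/
theorem bilin_basisVector_zero_unitNormal {p : E3} (hp : ‖p‖ < 1) :
    bilin (E4.basisVector 0) ((Real.sqrt (1 - ‖p‖ ^ 2))⁻¹ • E4.ofTimeSpace 1 p) < 0 := by
  have h1 : 0 < 1 - ‖p‖ ^ 2 := by nlinarith [norm_nonneg p]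
  rw [map_smul, smul_eq_mul, bilin_basisVector_zero_left, E4.ofTimeSpace_apply_zero]
  have : 0 < (Real.sqrt (1 - ‖p‖ ^ 2))⁻¹ := inv_pos.mpr (Real.sqrt_pos.mpr h1)
  linarith

/-- The unit normal is `η`-orthogonal to the tangent vectors of the graph:
`η(ν, (⟪p, v⟫, v)) = 0`. Wald 1984, §10.2. [cite: Wald1984, §10.2] -/
theorem bilin_unitNormal_tangent (p v : E3) :
    bilin ((Real.sqrt (1 - ‖p‖ ^ 2))⁻¹ • E4.ofTimeSpace 1 p) (E4.ofTimeSpace ⟪p, v⟫ v) = 0 := by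
  simp only [map_smul, FunLike.coe_smul, Pi.smul_apply, bilin_ofTimeSpace_one_tangent,
    smul_zero]

/-- **The metric induced on a graph**: `η((⟪p, v⟫, v), (⟪p, w⟫, w)) = ⟪v, w⟫ − ⟪p, v⟫ ⟪p, w⟫`,
i.e. `h = δ − du ⊗ du` for the graph of `u` with `du = ⟪p, ·⟫`. Wald 1984, §10.2, (10.2.11)
(`h_ab = g_ab + n_a n_b` evaluated on tangent vectors). [cite: Wald1984, §10.2 (10.2.11)] -/
theorem bilin_tangent_tangent (p v w : E3) :
    bilin (E4.ofTimeSpace ⟪p, v⟫ v) (E4.ofTimeSpace ⟪p, w⟫ w) = ⟪v, w⟫ - ⟪p, v⟫ * ⟪p, w⟫ := by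
  rw [bilin_ofTimeSpace]; ring

/-- **Graphs with `‖∇u‖ < 1` are spacelike, uniformly so under a gradient bound**: the induced
quadratic form dominates `(1 − ‖p‖²) ‖v‖²` (Cauchy–Schwarz: `⟪p, v⟫² ≤ ‖p‖² ‖v‖²`). Hence for
`‖∇u‖ ≤ θ < 1` the induced metric is uniformly equivalent to `δ` — the hypothesis under which
the graph is a Cauchy hypersurface (`Minkowski.isCauchyHypersurface_range_graph_of_fderiv`,
`SpacetimePositiveMassRigidityProofs`). O'Neill 1983, Ch. 5, p. 145.
[cite: ONeill1983, Ch. 5, p. 145] -/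
theorem bilin_tangent_self_ge (p v : E3) :
    (1 - ‖p‖ ^ 2) * ‖v‖ ^ 2 ≤ bilin (E4.ofTimeSpace ⟪p, v⟫ v) (E4.ofTimeSpace ⟪p, v⟫ v) := by
  rw [bilin_tangent_tangent, real_inner_self_eq_norm_sq]
  have hcs : ⟪p, v⟫ * ⟪p, v⟫ ≤ ‖p‖ ^ 2 * ‖v‖ ^ 2 := by
    have h := abs_real_inner_le_norm p v
    have h' : |⟪p, v⟫| * |⟪p, v⟫| ≤ (‖p‖ * ‖v‖) * (‖p‖ * ‖v‖) :=
      mul_le_mul h h (abs_nonneg _) (le_trans (abs_nonneg _) h)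
    rw [abs_mul_abs_self] at h'
    nlinarith [h']
  nlinarith [hcs]

/-! ### The graph map of a smooth function is a smooth embedding -/

/-- `∂ₜ` has no spatial part (coordinate bookkeeping; a private copy of a lemma repeated in
several files of the directory). [folklore] -/
private theorem spatial_basisVector_zero : E4.spatial (E4.basisVector 0) = 0 := by
  ext i
  simp [Fin.succ_ne_zero]

/-- **The graph map of a smooth function is a `C^∞` immersion** `ℝ³ → ℝ⁴` in the chart sense of
Mathlib's `Manifold.IsImmersion` (Hawking–Ellis 1973, §2.3, p. 23): in the identity chart of
`ℝ³` and the *sheared* chart `x ↦ x − u(x̲) ∂ₜ` of `ℝ⁴` (a `C^∞` diffeomorphism of `ℝ⁴` with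
inverse `x ↦ x + u(x̲) ∂ₜ`, hence a member of the maximal `C^∞` atlas of `ℝ⁴`,
`StructureGroupoid.mem_maximalAtlas_of_mem_groupoid`) the map `y ↦ (u(y), y)` reads
`y ↦ (0, y)`, i.e. `z ↦ e(z, 0)` for the linear isomorphism `e : ℝ³ × ℝ ≅ ℝ⁴`,
`(y, t) ↦ (t, y)` (`Manifold.IsImmersionAtOfComplement.mk_of_continuousAt`, complement
`F = ℝ`; the pattern of `Minkowski.isImmersion_sliceEmbed`, which is the case `u = 0`).
O'Neill 1983, Ch. 4, p. 97; Hawking–Ellis 1973, §2.3. [cite: ONeill1983, Ch. 4, p. 97] -/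
theorem isImmersion_graph {u : E3 → ℝ} (hu : ContDiff ℝ ∞ u) :
    Manifold.IsImmersion 𝓘(ℝ, E3) 𝓘(ℝ, E4) ∞ fun y : E3 ↦ E4.ofTimeSpace (u y) y := by
  -- the linear isomorphism `(y, t) ↦ (t, y) : E3 × ℝ ≅ E4`
  let eₗ : (E3 × ℝ) ≃ₗ[ℝ] E4 :=
    { toFun := fun p ↦ E4.ofTimeSpace p.2 p.1
      map_add' := fun p q ↦ E4.ofTimeSpace_add p.2 q.2 p.1 q.1
      map_smul' := fun c p ↦ E4.ofTimeSpace_smul c p.2 p.1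
      invFun := fun v ↦ (E4.spatial v, E4.time v)
      left_inv := fun p ↦ by simp
      right_inv := fun v ↦ E4.ofTimeSpace_time_spatial v }
  let e : (E3 × ℝ) ≃L[ℝ] E4 := eₗ.toContinuousLinearEquiv
  have he : ∀ p : E3 × ℝ, e p = E4.ofTimeSpace p.2 p.1 := fun _ ↦ rfl
  -- the shear `x ↦ x − u(x̲) ∂ₜ` and its inverse
  have hsp : ∀ (x : E4) (c : ℝ), E4.spatial (x + c • E4.basisVector 0) = E4.spatial x := by
    intro x c
    rw [map_add, map_smul, spatial_basisVector_zero, smul_zero, add_zero]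
  have hsp' : ∀ (x : E4) (c : ℝ), E4.spatial (x - c • E4.basisVector 0) = E4.spatial x := by
    intro x c
    rw [sub_eq_add_neg, ← neg_smul, hsp]
  let Ψ : E4 ≃ₜ E4 :=
    { toFun := fun x ↦ x - u (E4.spatial x) • E4.basisVector 0
      invFun := fun x ↦ x + u (E4.spatial x) • E4.basisVector 0
      left_inv := fun x ↦ by simp only [hsp']; abel
      right_inv := fun x ↦ by simp only [hsp]; abel
      continuous_toFun := continuous_id.sub
        ((hu.continuous.comp E4.spatial.continuous).smul continuous_const)
      continuous_invFun := continuous_id.add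
        ((hu.continuous.comp E4.spatial.continuous).smul continuous_const) }
  have hΨ : ContDiff ℝ ∞ (Ψ : E4 → E4) :=
    contDiff_id.sub ((hu.comp E4.spatial.contDiff).smul contDiff_const)
  have hΨs : ContDiff ℝ ∞ (Ψ.symm : E4 → E4) :=
    contDiff_id.add ((hu.comp E4.spatial.contDiff).smul contDiff_const)
  have hmem : Ψ.toOpenPartialHomeomorph ∈ IsManifold.maximalAtlas 𝓘(ℝ, E4) ∞ E4 := by
    apply StructureGroupoid.mem_maximalAtlas_of_mem_groupoid
    rw [contDiffGroupoid, mem_groupoid_of_pregroupoid]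
    refine ⟨?_, ?_⟩
    · simpa [contDiffPregroupoid] using hΨ.contDiffOn
    · simpa [contDiffPregroupoid] using hΨs.contDiffOn
  refine ⟨ℝ, inferInstance, inferInstance, fun x ↦ ?_⟩
  refine Manifold.IsImmersionAtOfComplement.mk_of_continuousAt
    (continuous_graph hu.continuous).continuousAt e (chartAt E3 x) Ψ.toOpenPartialHomeomorph
    (mem_chart_source E3 x) (by simp) (IsManifold.chart_mem_maximalAtlas x) hmem ?_
  intro z _
  calc (Ψ.toOpenPartialHomeomorph.extend 𝓘(ℝ, E4))
        (E4.ofTimeSpace (u (((chartAt E3 x).extend 𝓘(ℝ, E3)).symm z))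
          (((chartAt E3 x).extend 𝓘(ℝ, E3)).symm z))
      = Ψ (E4.ofTimeSpace (u z) z) := rfl
    _ = E4.ofTimeSpace 0 z := by
        change E4.ofTimeSpace (u z) z - u (E4.spatial (E4.ofTimeSpace (u z) z)) • E4.basisVector 0
          = E4.ofTimeSpace 0 z
        rw [E4.spatial_ofTimeSpace, E4.ofTimeSpace_eq_smul_add (u z) z]
        abel
    _ = e (z, 0) := (he (z, 0)).symm

/-- **The graph of a smooth function over `{t = 0}` is a smoothly embedded hypersurface of
Minkowski space-time**: `y ↦ (u(y), y)` is a `C^∞` embedding `ℝ³ → ℝ⁴` (an immersion,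
`isImmersion_graph`, which is a homeomorphism onto its closed image, `isClosedEmbedding_graph`) —
an imbedding in the sense of Hawking–Ellis 1973, §2.3, p. 23, whose image is a hypersurface
(§2.7, p. 44); the case `u = 0` is `Minkowski.isSmoothEmbedding_sliceEmbed_holds` (`ModelData`).
This is the regularity clause of the embedding produced by the rigid positive energy theorem
(Beig–Chruściel 1996, Thm. 4.1: "an isometric embedding `i` of `Σ` into Minkowski space-time",
whose image is an entire graph over `{t = 0}`).
[cite: HawkingEllis1973, §2.3 p. 23 and §2.7 p. 44] -/
theorem isSmoothEmbedding_graph {u : E3 → ℝ} (hu : ContDiff ℝ ∞ u) :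
    Manifold.IsSmoothEmbedding 𝓘(ℝ, E3) 𝓘(ℝ, E4) ∞ fun y : E3 ↦ E4.ofTimeSpace (u y) y :=
  ⟨isImmersion_graph hu, (isClosedEmbedding_graph hu.continuous).isEmbedding⟩

end Minkowski

end Literature.Geometry.Lorentzian

end
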